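import Summits.ResolutionOfSingularities.ResolutionOfSingularities.Theorems.FrobeniusClosingPatchingRelPerfectDepthSepCJSPieceStep
import Summits.ResolutionOfSingularities.ResolutionOfSingularities.Theorems.FrobeniusClosingPatchingRelPerfectDepthSepTargets
import Literature.AlgebraicGeometry.Resolution.BlowupDisjointCentreSplitting
import Literature.AlgebraicGeometry.Resolution.StrictTransformClosedSetPieces
import Literature.AlgebraicGeometry.Resolution.BlowupsIntegral
import HarnessLib

/-!
# Crux `PatchingRelPerfect` (stmt-ResolutionOfSingularities-16161), chain W5.2 — F6 STAGE 2, target T6-E2 `SeparationBoundaryNil₃`,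
# PHASE A: the PIECES LOOP — one `IsSepSeq.cons` (TargetsF6 §4, p523708) per connected piece of a CJS centre

[OURS · L1 W5.2 · TargetsF6 T6-E2 Phase A] Fact-free; NOT statements of the manuscript under review (Hironaka 2017).  The weight-ONE
port of T5-E's `WeightTwoB.piece_cons` / `WeightTwoB.pieces_loop` (res-D-pv-054 / res-type-049, p519847 / p519856): from a Phase-A
transport state `SepCJS.StateA 𝔟 H ℬ 𝒟` at the end of a weight-one sequence `DepthTargets.IsSepSeq ρ 𝔟₀ [] 𝔟 𝒟`, a regular centre
`C` with a non-empty piece partition `Zs`, each piece carrying its `SepCJS.CentreA` data (ORD2 included), a boundary bound `B₀`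
containing the traces and `V(C)` and COVERED by the traces together with `V(C)`, and ANY blowing up `τ` along `C`:
the sequence extends along `τ` by one `IsSepSeq.cons` per piece — every clause read off the state (`…DepthSepCJSState` §3: the
centre clauses, the boundary clauses for `𝒟`, and the JOINT clause VACUOUSLY since `ord ≥ 2` along the piece) — to a transport
state on `W'` whose host support is the strict transform `cl τ⁻¹(Supp H ∖ V(C))`, whose traces lie over `B₀`, and whose traces
COVER `τ⁻¹B₀` (the E-side form of CJS's `B_{j+1} = τ⁻¹(B_j ∪ D_j)`, needed to read ORD2 at the next CJS centre).  The blow-up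
along `C` is split along the pieces by the tree's `IsBlowup.exists_comp_eq_of_isPiecePartition_cons`; the centre data of the
remaining pieces are transported by `SepCJS.CentreA.transport`; supports compose by
`IsBlowup.closure_preimage_closure_preimage_diff` ((L-G), res-type-049).

AI-written; AI review is weaker than expert review.

## References
* E. Bierstone, D. Grigoriev, P. Milman, J. Włodarczyk, arXiv:1206.3090, Def. 3.1.3, §4 Step 2b. [BierstoneGrigorievMilmanWlodarczyk2011]
* V. Cossart, U. Jannsen, S. Saito, LNM 2270 (2020), Thm. 1.4, Def. 4.1, (6.2), Thm. 6.9 (a). [CossartJannsenSaito2020]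
* J. Kollár, *Lectures on Resolution of Singularities* (2007), 3.30.2, (3.111) Step 1. [Kollar2007]
* The Stacks Project, Tag 080A (blowing up a disjoint union of centres). [StacksProject]
-/

-- `Summit.<Summit>.<Sub>.Theorems` with `Sub = Summit` (single-conjunct summit, D-0017)
set_option linter.dupNamespace false

noncomputable section

open CategoryTheory CategoryTheory.Limits AlgebraicGeometry TopologicalSpace IsLocalRing
open Literature.AlgebraicGeometry.Resolution Scheme.IdealSheafData
open Literature.AlgebraicGeometry.Hironaka2017.S16Proof
open Literature.AlgebraicGeometry.Hironaka2017.MonomialPart Literature.AlgebraicGeometry.Hironaka2017.MonomialComponent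

namespace Summit.ResolutionOfSingularities.ResolutionOfSingularities.Theorems

universe u

namespace SepCJS

open DepthSNC WeightTwoB DepthTargets

/-! ## One piece -/

/-- **The single-piece step, packaged**: blowing up ONE piece `Z` of the current Phase-A state extends the weight-one sequence by
one `IsSepSeq.cons` (JOINT vacuous by ORD2) and yields the new state (host order `m = ord_η H`, new trace multiplicity
`m + w − 1`, the format's new N-exponent `w_𝒟 + 1`), the support of the carried host, the boundary bound and the boundary cover.
[cite: BierstoneGrigorievMilmanWlodarczyk2011, §4 Step 2b] [cite: CossartJannsenSaito2020, (6.2), Def. 4.1] [cite: Kollar2007, 3.30.2] -/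
theorem piece_single
    {E W : Scheme.{u}} [IsIntegral W] [IsNoetherian W] {ρ : W ⟶ E} {𝔟₀ : E.IdealSheafData}
    {𝔟 H : W.IdealSheafData} {ℬ 𝒟 : List (W.IdealSheafData × ℕ)} (S : StateA 𝔟 H ℬ 𝒟)
    (hseq : IsSepSeq ρ 𝔟₀ ([] : List (E.IdealSheafData × ℕ)) 𝔟 𝒟)
    {Z : Closeds W} (Γ : CentreA 𝔟 H ℬ Z)
    {B₀ : Set W} (hℬB : ∀ p ∈ ℬ, (p.1.support : Set W) ⊆ B₀) (hZB : (Z : Set W) ⊆ B₀)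
    {W' : Scheme.{u}} {τ : W' ⟶ W} (hτ : IsBlowup τ (vanishingIdeal Z)) :
    ∃ (_ : IsIntegral W') (_ : IsNoetherian W') (m e e' : ℕ),
      IsSepSeq (τ ≫ ρ) 𝔟₀ ([] : List (E.IdealSheafData × ℕ)) (controlledTransform τ (vanishingIdeal Z) 𝔟 1)
          (stepExp 𝒟 τ (vanishingIdeal Z) e') ∧
        StateA (controlledTransform τ (vanishingIdeal Z) 𝔟 1) (controlledTransform τ (vanishingIdeal Z) H m)
          (stepExp ℬ τ (vanishingIdeal Z) e) (stepExp 𝒟 τ (vanishingIdeal Z) e') ∧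
        (((controlledTransform τ (vanishingIdeal Z) H m).support : Set W') =
          closure (τ ⁻¹' ((H.support : Set W) \ (Z : Set W)))) ∧
        (∀ p ∈ stepExp ℬ τ (vanishingIdeal Z) e, (p.1.support : Set W') ⊆ τ ⁻¹' B₀) ∧
        (∀ x' : W', ((∃ p ∈ ℬ, τ x' ∈ p.1.support) ∨ τ x' ∈ (Z : Set W)) →
          ∃ p ∈ stepExp ℬ τ (vanishingIdeal Z) e, x' ∈ p.1.support) := by
  obtain ⟨η, hη⟩ := Γ.exists_isGenericPoint
  have P : PieceIn 𝔟 H ℬ [] Z η := S.pieceIn Γ hη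
  obtain ⟨m, hm, hm1⟩ := P.exists_idealOrder_host_eq
  -- the centre is not the zero ideal: `Z ⊆ Supp H`, a proper closed subset
  have hCne : vanishingIdeal Z ≠ ⊥ := by
    intro h0
    have hZ : (Z : Set W) = Set.univ := by
      rw [← Scheme.IdealSheafData.coe_support_vanishingIdeal Z, h0, Scheme.IdealSheafData.support_bot]; rfl
    have hdense := S.hostCartier.dense_compl_support
    have hempty : ((H.support : Set W)ᶜ) = ∅ := by
      rw [Set.compl_empty_iff, Set.eq_univ_iff_forall]
      intro x
      exact Γ.subZ (by rw [hZ]; trivial)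
    have := hdense.nonempty
    rw [hempty] at this
    exact Set.not_nonempty_empty this
  haveI hint' : IsIntegral W' := hτ.isIntegral hCne
  haveI hnoeth' : IsNoetherian W' := isNoetherian_of_isBlowup hτ
  set w := weightOf ℬ (divisorsOver ℬ (vanishingIdeal Z) (vanishingIdeal Z).support) with hw
  set w𝒟 := weightOf 𝒟 (divisorsOver 𝒟 (vanishingIdeal Z) (vanishingIdeal Z).support) with hw𝒟
  refine ⟨hint', hnoeth', m, m + w - 1, w𝒟 + 1, ?_, stateA' S Γ hη hτ hm _, support_host' S Γ hη hτ hm, ?_,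
    fun x' hx => cover' hτ _ hx⟩
  · -- the `cons` step: every clause from the state; JOINT vacuous
    exact IsSepSeq.cons τ ρ 𝔟₀ [] 𝔟 𝒟 (vanishingIdeal Z) hseq Γ.regZ P.isPreconnected (S.le_centre Γ) (S.sncZ𝒟 Γ)
      (StateA.uniformPieces𝒟 hη) (fun z hz hord => absurd (StateA.stalkIdeal_le_sq Γ hz) hord) hτ
  · -- the boundary bound
    intro p hp
    rcases mem_stepExp_iff.mp hp with ⟨q, hq, rfl⟩ | rfl
    · intro x' hx'
      exact hℬB q hq (mem_support_of_mem_support_strictTransformIdeal hx')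
    · intro x' hx'
      rw [Scheme.IdealSheafData.support_comap, Closeds.coe_preimage, Scheme.IdealSheafData.coe_support_vanishingIdeal] at hx'
      exact hZB hx'

/-! ## The loop -/

/-- The induction behind `pieces_loop`, on the number of pieces. [cite: BierstoneGrigorievMilmanWlodarczyk2011, §4 Step 2b] -/
private theorem pieces_loop_aux {E : Scheme.{u}} {𝔟₀ : E.IdealSheafData} (n : ℕ) :
    ∀ {W : Scheme.{u}} [IsIntegral W] [IsNoetherian W] {ρ : W ⟶ E}
      {𝔟 H : W.IdealSheafData} {ℬ 𝒟 : List (W.IdealSheafData × ℕ)} (_S : StateA 𝔟 H ℬ 𝒟)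
      (_hseq : IsSepSeq ρ 𝔟₀ ([] : List (E.IdealSheafData × ℕ)) 𝔟 𝒟)
      {C : W.IdealSheafData} (_hC : Scheme.IsRegular C.subscheme)
      {Zs : List (Closeds W)} (_hlen : Zs.length = n) (_hne : Zs ≠ []) (_hP : IsPiecePartition C Zs)
      (_hΓ : ∀ Z ∈ Zs, CentreA 𝔟 H ℬ Z)
      {B₀ : Set W} (_hℬB : ∀ p ∈ ℬ, (p.1.support : Set W) ⊆ B₀) (_hCB : (C.support : Set W) ⊆ B₀)
      (_hcov : ∀ x ∈ B₀, (∃ p ∈ ℬ, x ∈ p.1.support) ∨ x ∈ (C.support : Set W))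
      {W' : Scheme.{u}} {τ : W' ⟶ W} (_hτ : IsBlowup τ C),
      ∃ (_ : IsIntegral W') (_ : IsNoetherian W') (𝔟' H' : W'.IdealSheafData) (ℬ' 𝒟' : List (W'.IdealSheafData × ℕ)),
        IsSepSeq (τ ≫ ρ) 𝔟₀ ([] : List (E.IdealSheafData × ℕ)) 𝔟' 𝒟' ∧ StateA 𝔟' H' ℬ' 𝒟' ∧
        ((H'.support : Set W') = closure (τ ⁻¹' ((H.support : Set W) \ C.support))) ∧
        (∀ p ∈ ℬ', (p.1.support : Set W') ⊆ τ ⁻¹' B₀) ∧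
        (∀ x' : W', τ x' ∈ B₀ → ∃ p ∈ ℬ', x' ∈ p.1.support) := by
  induction n with
  | zero =>
    intro W _ _ ρ 𝔟 H ℬ 𝒟 S hseq C hC Zs hlen hne
    exact absurd (List.eq_nil_of_length_eq_zero hlen) hne
  | succ n ih =>
    intro W _ _ ρ 𝔟 H ℬ 𝒟 S hseq C hC Zs hlen hne hP hΓ B₀ hℬB hCB hcov W' τ hτ
    obtain ⟨Z, Zs', rfl⟩ : ∃ Z Zs', Zs = Z :: Zs' := by
      cases Zs with
      | nil => exact absurd rfl hne
      | cons Z Zs' => exact ⟨Z, Zs', rfl⟩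
    have hlen' : Zs'.length = n := by simpa using hlen
    have hZC : (Z : Set W) ⊆ (C.support : Set W) := by
      rw [← hP.2]
      exact Set.subset_iUnion₂ (s := fun (Z' : Closeds W) (_ : Z' ∈ Z :: Zs') => (Z' : Set W)) Z List.mem_cons_self
    have hZB : (Z : Set W) ⊆ B₀ := hZC.trans hCB
    by_cases hnil : Zs' = []
    · -- ONE piece: `C = 𝓘(Z)`
      subst hnil
      have hCZ : C = vanishingIdeal Z := by
        rw [← prod_pieceIdeals_eq_of_isRegular hC hP]; simp [pieceIdeals]
      subst hCZ
      obtain ⟨hint', hnoeth', m, e, e', hseq', S', hsupp, hbd, hcov'⟩ :=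
        piece_single S hseq (hΓ Z List.mem_cons_self) hℬB hZB hτ
      refine ⟨hint', hnoeth', _, _, _, _, hseq', S', ?_, hbd, fun x' hx' => hcov' x' ?_⟩
      · rw [hsupp, Scheme.IdealSheafData.coe_support_vanishingIdeal]
      · rcases hcov (τ x') hx' with h | h
        · exact Or.inl h
        · right; rwa [Scheme.IdealSheafData.coe_support_vanishingIdeal] at h
    · -- SEVERAL pieces: blow up the first, transport the rest
      obtain ⟨X₁, τ₁, τ₂, hcomp, hτ₁, -, -, -, -, hτ₂, hC₁, hP₁⟩ := hτ.exists_comp_eq_of_isPiecePartition_cons hC hP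
      obtain ⟨hint₁, hnoeth₁, m, e, e', hseq₁, S₁, hsupp₁, hbd₁, hcov₁⟩ :=
        piece_single S hseq (hΓ Z List.mem_cons_self) hℬB hZB hτ₁
      haveI := hint₁
      haveI := hnoeth₁
      -- the centre data of the lifted remaining pieces
      have hΓ₁ : ∀ Z₁ ∈ Zs'.map (fun W₀ : Closeds W => W₀.preimage τ₁.continuous),
          CentreA (controlledTransform τ₁ (vanishingIdeal Z) 𝔟 1) (controlledTransform τ₁ (vanishingIdeal Z) H m)
            (stepExp ℬ τ₁ (vanishingIdeal Z) e) Z₁ := by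
        intro Z₁ hZ₁
        obtain ⟨Z₂, hZ₂, rfl⟩ := List.mem_map.mp hZ₁
        exact CentreA.transport (hΓ Z List.mem_cons_self) hτ₁ (hΓ Z₂ (List.mem_cons_of_mem _ hZ₂))
          (hP.disjoint_of_mem_tail hZ₂) e
      have hne₁ : Zs'.map (fun W₀ : Closeds W => W₀.preimage τ₁.continuous) ≠ [] := by
        simpa using hnil
      have hlen₁ : (Zs'.map (fun W₀ : Closeds W => W₀.preimage τ₁.continuous)).length = n := by simpa using hlen'
      -- the support of the remaining centre lies over `⋃ Zs' ⊆ V(C) ⊆ B₀`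
      set T : Set W := ⋃ Z₂ ∈ Zs', (Z₂ : Set W) with hT
      have hC₁supp : (((pieceIdeals (Zs'.map fun W₀ : Closeds W => W₀.preimage τ₁.continuous)).prod).support : Set X₁) =
          τ₁ ⁻¹' T := by
        rw [← hP₁.2, hT]
        ext x
        simp only [List.mem_map, Set.mem_iUnion, exists_prop, Set.mem_preimage]
        constructor
        · rintro ⟨_, ⟨Z₂, hZ₂, rfl⟩, hx⟩
          exact ⟨Z₂, hZ₂, hx⟩
        · rintro ⟨Z₂, hZ₂, hx⟩
          exact ⟨_, ⟨Z₂, hZ₂, rfl⟩, hx⟩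
      have hTC : T ⊆ (C.support : Set W) := by
        rw [← hP.2, hT]
        exact Set.iUnion₂_subset fun Z₂ hZ₂ =>
          Set.subset_iUnion₂ (s := fun (Z' : Closeds W) (_ : Z' ∈ Z :: Zs') => (Z' : Set W)) Z₂ (List.mem_cons_of_mem _ hZ₂)
      have hZT : (Z : Set W) ∪ T = (C.support : Set W) := by
        rw [← hP.2, hT]
        ext x
        simp only [Set.mem_union, Set.mem_iUnion, List.mem_cons, exists_prop]
        constructor
        · rintro (hx | ⟨Z₂, hZ₂, hx⟩)
          · exact ⟨Z, Or.inl rfl, hx⟩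
          · exact ⟨Z₂, Or.inr hZ₂, hx⟩
        · rintro ⟨Z', rfl | hZ', hx⟩
          · exact Or.inl hx
          · exact Or.inr ⟨Z', hZ', hx⟩
      have hCB₁ : (((pieceIdeals (Zs'.map fun W₀ : Closeds W => W₀.preimage τ₁.continuous)).prod).support : Set X₁) ⊆
          τ₁ ⁻¹' B₀ := by
        rw [hC₁supp]; exact Set.preimage_mono (hTC.trans hCB)
      -- the cover of `τ₁⁻¹ B₀` by the new traces and the remaining centre
      have hcov₁' : ∀ x₁ ∈ τ₁ ⁻¹' B₀, (∃ p ∈ stepExp ℬ τ₁ (vanishingIdeal Z) e, x₁ ∈ p.1.support) ∨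
          x₁ ∈ ((((pieceIdeals (Zs'.map fun W₀ : Closeds W => W₀.preimage τ₁.continuous)).prod).support : Set X₁)) := by
        intro x₁ hx₁
        rcases hcov (τ₁ x₁) hx₁ with h | h
        · exact Or.inl (hcov₁ x₁ (Or.inl h))
        · rw [← hZT] at h
          rcases h with h | h
          · exact Or.inl (hcov₁ x₁ (Or.inr h))
          · right; rw [hC₁supp]; exact h
      -- the induction hypothesis on the remaining pieces
      obtain ⟨hint', hnoeth', 𝔟', H', ℬ', 𝒟', hseq', S', hsupp', hbd', hcov'⟩ :=
        ih S₁ hseq₁ hC₁ hlen₁ hne₁ hP₁ hΓ₁ hbd₁ hCB₁ hcov₁' hτ₂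
      refine ⟨hint', hnoeth', 𝔟', H', ℬ', 𝒟', ?_, S', ?_, ?_, ?_⟩
      · rw [← hcomp, Category.assoc]; exact hseq'
      · -- supports: two-step strict transform = one-step ((L-G))
        rw [hsupp', hsupp₁, hC₁supp, hτ₂.closure_preimage_closure_preimage_diff τ₁ hC₁supp (H.support : Set W) (Z : Set W),
          hcomp, hZT]
      · intro p hp x' hx'
        have h1 := hbd' p hp hx'
        rw [← hcomp]
        simp only [Set.mem_preimage, Scheme.Hom.comp_base, TopCat.coe_comp, Function.comp_apply] at h1 ⊢
        exact h1
      · intro x' hx'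
        refine hcov' x' ?_
        rw [← hcomp] at hx'
        simp only [Set.mem_preimage, Scheme.Hom.comp_base, TopCat.coe_comp, Function.comp_apply] at hx' ⊢
        exact hx'

/-- [OURS · L1 W5.2 · T6-E2 Phase A] **THE PIECES LOOP** (see the module docstring).
[cite: BierstoneGrigorievMilmanWlodarczyk2011, §4 Step 2b, Def. 3.1.3] [cite: CossartJannsenSaito2020, Thm. 1.4, (6.2)]
[cite: StacksProject, Tag 080A] -/
theorem pieces_loop
    {E W : Scheme.{u}} [IsIntegral W] [IsNoetherian W] {ρ : W ⟶ E} {𝔟₀ : E.IdealSheafData}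
    {𝔟 H : W.IdealSheafData} {ℬ 𝒟 : List (W.IdealSheafData × ℕ)} (S : StateA 𝔟 H ℬ 𝒟)
    (hseq : IsSepSeq ρ 𝔟₀ ([] : List (E.IdealSheafData × ℕ)) 𝔟 𝒟)
    {C : W.IdealSheafData} (hC : Scheme.IsRegular C.subscheme)
    {Zs : List (Closeds W)} (hne : Zs ≠ []) (hP : IsPiecePartition C Zs) (hΓ : ∀ Z ∈ Zs, CentreA 𝔟 H ℬ Z)
    {B₀ : Set W} (hℬB : ∀ p ∈ ℬ, (p.1.support : Set W) ⊆ B₀) (hCB : (C.support : Set W) ⊆ B₀)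
    (hcov : ∀ x ∈ B₀, (∃ p ∈ ℬ, x ∈ p.1.support) ∨ x ∈ (C.support : Set W))
    {W' : Scheme.{u}} {τ : W' ⟶ W} (hτ : IsBlowup τ C) :
    ∃ (_ : IsIntegral W') (_ : IsNoetherian W') (𝔟' H' : W'.IdealSheafData) (ℬ' 𝒟' : List (W'.IdealSheafData × ℕ)),
      IsSepSeq (τ ≫ ρ) 𝔟₀ ([] : List (E.IdealSheafData × ℕ)) 𝔟' 𝒟' ∧ StateA 𝔟' H' ℬ' 𝒟' ∧
      ((H'.support : Set W') = closure (τ ⁻¹' ((H.support : Set W) \ C.support))) ∧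
      (∀ p ∈ ℬ', (p.1.support : Set W') ⊆ τ ⁻¹' B₀) ∧
      (∀ x' : W', τ x' ∈ B₀ → ∃ p ∈ ℬ', x' ∈ p.1.support) :=
  pieces_loop_aux Zs.length S hseq hC rfl hne hP hΓ hℬB hCB hcov hτ

end SepCJS

end Summit.ResolutionOfSingularities.ResolutionOfSingularities.Theorems

end
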